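import Literature.MathematicalPhysics.KineticTheory.HardSphereDLRActivityDerivative
import Literature.MathematicalPhysics.KineticTheory.HardSphereGibbsGNZIdentity
import HarnessLib

/-!
# Uniqueness of the translation-invariant hard-sphere Gibbs state at low density (every dimension `≥ 1`)

(topic MathematicalPhysics/KineticTheory; theorems only, no new definitions, no new named facts; the
general-dimension port — `EuclideanSpace ℝ ι` with `ι` nonempty, namespace `HardSphereDLR`, `ℝ³` in the
comments standing for `ℝ^ι` and `1/(64ε³)` for `1/(8(2ε)^{#ι})` — of
`StatisticalMechanics/LowDensityHardSphereGibbsUniqueness.lean`; ninth file of the general-`d` port needed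
for `HardSphereGibbsLowDensityUniqueness`, whose dimension-`0` case and assembly are in
`Georgii1995HardSphereCanonicalLocalLimitProofs.lean`.)

This file proves, for every nonempty finite index type `ι`, the statement of the named fact
`Literature.MathematicalPhysics.KineticTheory.HardSphereGibbsLowDensityUniqueness` (Ruelle 1969,
Thm 4.2.3 with Georgii 1995, Remark 3.7: in the low-density/small-activity regime the activity is a
bijective function of the density, so a translation-invariant tempered hard-sphere Gibbs measure of
small density is unique):

* `hardSphereGibbsLowDensityUniqueness_of_nonempty` — for every diameter `ε > 0` there is `ρ₀ > 0` such
  that two translation-invariant solutions `G, G'` of the hard-sphere DLR equations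
  (`Literature.Analysis.FluidPDE.IsHardSphereGibbs ε z β u`, `… ε z' β u`) with activities `z, z' > 0`, the same inverse
  temperature and drift, and the same particle density `ρ < ρ₀`, coincide.

The proof assembles four tree results.  (B) The GNZ sandwich `z(1 - n³ρ) ≤ ρ ≤ z`
(`activity_le_two_mul_density`, Dereudre 2019 Prop. 10): small density forces small
activity, `z, z' ≤ 2ρ`.  (C₀) The one-point GNZ identity `ρ = z · G{B°_ε(0) × ℝ³ empty}`
(`density_eq_activity_mul_measure_ball_empty`).  (C) The vacancy probability
`q(G) = G{B°_ε(0) × ℝ³ empty}` of ANY DLR state is a Lipschitz function of the activity on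
`[0, 1/(64ε³)]` (`abs_measureReal_vacant_sub_le_of_isHardSphereGibbs` below): every DLR state is pinned,
uniformly in the activity, by the free finite-volume distributions `γ^z_{B(0,R)}(∅)` (the
disagreement estimate `IsHsLocalGibbs.abs_measureReal_sub_hsLocalSpec_empty_le`, Michelen–Perkins 2021
Thm 25), and these are Lipschitz in `z` uniformly in `R` (`abs_hsLocalSpec_empty_vacant_sub_le`,
Ruelle's activity-derivative formula plus covariance decay).  Hence `ρ = z q = z' q'` with
`q' ≥ 1/2` and `|q - q'| ≤ L|z - z'|` forces `z = z'` once `2ρ₀L < 1/4`.  (A) Uniqueness of the DLR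
state at small activity (`IsHardSphereGibbs.unique_of_small_activity`, `16 z ε³ < 1`) then gives
`G = G'`.


## References

* D. Ruelle, *Statistical Mechanics: Rigorous Results*, Benjamin 1969, §4.2, Thm 4.2.3. [Ruelle1969]
* H.-O. Georgii, *The equivalence of ensembles for classical systems of particles*, J. Stat. Phys.
  80 (1995), Thm 3.4 and Remark 3.7. [Georgii1995]
* M. Michelen, W. Perkins, arXiv:2109.01094, Thm 3, Thm 25. [MichelenPerkins2021]
* D. Dereudre, *Introduction to the theory of Gibbs point processes*, 2019, Thm 2, Prop. 10. [Dereudre2019]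
-/

noncomputable section

open MeasureTheory ProbabilityTheory Set Filter Function Metric
open scoped ENNReal NNReal Topology

namespace Literature.MathematicalPhysics.KineticTheory

namespace HardSphereDLR

open Literature.Analysis.FluidPDE (IsHardCore isHardCore_empty IsHardSphereGibbs IsTranslationInvariant)
open Literature.Analysis.FunctionSpaces
open Literature.MathematicalPhysics.StatisticalMechanics (window mem_window measurableSet_window window_mono)

variable {ι : Type*} [Fintype ι]

/-! ### Pinning of the vacancy probability, uniformly in the activity -/

section Pinning

variable (M : Measure (EuclideanSpace ℝ ι)) [IsProbabilityMeasure M] {σ : ℝ}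

/-- The vacancy event of `B°_σ(0) × ℝ³` is a local event over `B(0, ⌈σ⌉)`. [folklore] -/
theorem preimage_restrict_window_ceil_vacant (σ : ℝ) :
    PointConfig.restrict (window (Metric.ball (0 : EuclideanSpace ℝ ι) (⌈σ⌉₊ : ℕ))) ⁻¹'
        {c : PointConfig (EuclideanSpace ℝ ι × EuclideanSpace ℝ ι) | c.count (window (Metric.ball (0 : EuclideanSpace ℝ ι) σ)) = 0} =
      {c : PointConfig (EuclideanSpace ℝ ι × EuclideanSpace ℝ ι) | c.count (window (Metric.ball (0 : EuclideanSpace ℝ ι) σ)) = 0} := by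
  have hsub : window (Metric.ball (0 : EuclideanSpace ℝ ι) σ) ⊆ window (Metric.ball (0 : EuclideanSpace ℝ ι) (⌈σ⌉₊ : ℕ)) := by
    intro y hy
    rw [mem_window] at hy ⊢
    exact Metric.ball_subset_ball (Nat.le_ceil σ) hy
  ext c
  simp only [mem_preimage, mem_setOf_eq, PointConfig.count_restrict, inter_eq_right.2 hsub]

/-- **Pinning of the vacancy probability of a DLR state by the free finite-volume distributions,
uniformly in the activity `z ≤ 1/(64σ³)`**: for `ν_z = z · Leb ⊗ M`, any DLR state `μ` of `(σ, ν_z)`,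
`k = ⌈σ⌉` and `R_d = k + (d+2)σ`,
`|μ(V) - γ^z_{B(0,R_d)}(∅)(V)| ≤ 2 B e^B 4^{-d}` with `B = (2k)³/(64σ³)` (`ν_z(B(0,k) × ℝ³) ≤ z(2k)³ ≤ B`,
`2κ = 16 z σ³ ≤ 1/4`). [cite: MichelenPerkins2021, §5, proof of Thm 25] -/
theorem abs_measureReal_vacant_sub_hsLocalSpec_empty_le [Nonempty ι] (hσ : 0 < σ) {z : ℝ} (hz : 0 ≤ z)
    (hz1 : z ≤ 1 / (8 * (2 * σ) ^ Fintype.card ι)) {μ : Measure (PointConfig (EuclideanSpace ℝ ι × EuclideanSpace ℝ ι))}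
    (hμ : IsHsLocalGibbs σ ((Real.toNNReal z) • ((volume : Measure (EuclideanSpace ℝ ι)).prod M)) μ) (d : ℕ) :
    |μ.real {c : PointConfig (EuclideanSpace ℝ ι × EuclideanSpace ℝ ι) | c.count (window (Metric.ball (0 : EuclideanSpace ℝ ι) σ)) = 0} -
      (hsLocalSpec σ ((Real.toNNReal z) • ((volume : Measure (EuclideanSpace ℝ ι)).prod M))
        (Metric.ball 0 ((⌈σ⌉₊ : ℕ) + ((d : ℝ) + 2) * σ)) ∅
        {c : PointConfig (EuclideanSpace ℝ ι × EuclideanSpace ℝ ι) | c.count (window (Metric.ball (0 : EuclideanSpace ℝ ι) σ)) = 0}).toReal| ≤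
      2 * ((2 * (⌈σ⌉₊ : ℕ)) ^ Fintype.card ι / (8 * (2 * σ) ^ Fintype.card ι)) * Real.exp ((2 * (⌈σ⌉₊ : ℕ)) ^ Fintype.card ι / (8 * (2 * σ) ^ Fintype.card ι)) *
        (1 / 4 : ℝ) ^ d := by
  set ν : Measure (EuclideanSpace ℝ ι × EuclideanSpace ℝ ι) := (Real.toNNReal z) • ((volume : Measure (EuclideanSpace ℝ ι)).prod M) with hν
  haveI : IsLocallyFiniteMeasure ν := by rw [hν]; infer_instance
  set k : ℕ := ⌈σ⌉₊ with hk
  set B : ℝ := (2 * (k : ℝ)) ^ Fintype.card ι / (8 * (2 * σ) ^ Fintype.card ι) with hB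
  have h0 : ∀ x, ν {x} = 0 := smul_prod_singleton z M
  have hm : ∀ t : ℝ, ν {y : EuclideanSpace ℝ ι × EuclideanSpace ℝ ι | y.1 (Classical.arbitrary ι) = t} = 0 := smul_prod_setOf_fst_apply (Classical.arbitrary ι) z M
  have hκ0 : (0 : ℝ) ≤ z * (2 * σ) ^ Fintype.card ι := by positivity
  have hκ : ∀ q : EuclideanSpace ℝ ι, ν (window (Metric.ball q σ)) ≤ ENNReal.ofReal (z * (2 * σ) ^ Fintype.card ι) := fun q => by
    rw [hν, smul_prod_window, measure_univ, mul_one, show z * (2 * σ) ^ Fintype.card ι = z * (2 * σ) ^ Fintype.card ι by ring,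
      ENNReal.ofReal_mul hz, ENNReal.ofReal_pow (by positivity)]
    gcongr
    exact volume_ball_le q σ
  have hfin : ∀ R : ℝ, ν (window (Metric.ball (0 : EuclideanSpace ℝ ι) R)) ≠ ∞ := fun R => by
    rw [hν, smul_prod_window, measure_univ, mul_one]
    exact ENNReal.mul_ne_top ENNReal.ofReal_ne_top Metric.isBounded_ball.measure_lt_top.ne
  have hVm : MeasurableSet {c : PointConfig (EuclideanSpace ℝ ι × EuclideanSpace ℝ ι) | c.count (window (Metric.ball (0 : EuclideanSpace ℝ ι) σ)) = 0} :=
    measurableSet_count_eq_zero (measurableSet_window_ball σ ((0 : EuclideanSpace ℝ ι), (0 : EuclideanSpace ℝ ι)))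
  have h := hμ.abs_measureReal_sub_hsLocalSpec_empty_le (Classical.arbitrary ι) ν hσ h0 hm hκ0 hκ hfin k d hVm
  rw [preimage_restrict_window_ceil_vacant] at h
  refine h.trans ?_
  -- the constants
  have hσ3 : 0 < σ ^ Fintype.card ι := by positivity
  have hz64 : z * (2 * (k : ℝ)) ^ Fintype.card ι ≤ B := by
    rw [hB, le_div_iff₀ (by positivity)]
    calc z * (2 * (k : ℝ)) ^ Fintype.card ι * (8 * (2 * σ) ^ Fintype.card ι) = (z * (8 * (2 * σ) ^ Fintype.card ι)) * (2 * (k : ℝ)) ^ Fintype.card ι := by ring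
      _ ≤ 1 * (2 * (k : ℝ)) ^ Fintype.card ι := by
          gcongr
          calc z * (8 * (2 * σ) ^ Fintype.card ι) ≤ 1 / (8 * (2 * σ) ^ Fintype.card ι) * (8 * (2 * σ) ^ Fintype.card ι) := by gcongr
            _ = 1 := by field_simp
      _ = (2 * (k : ℝ)) ^ Fintype.card ι := one_mul _
  have hνW : ν.real (window (Metric.ball (0 : EuclideanSpace ℝ ι) k)) ≤ B := by
    rw [measureReal_def, hν, smul_prod_window, measure_univ, mul_one]
    have h1 : ENNReal.ofReal z * volume (Metric.ball (0 : EuclideanSpace ℝ ι) k) ≤ ENNReal.ofReal (z * (2 * (k : ℝ)) ^ Fintype.card ι) := by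
      rw [ENNReal.ofReal_mul hz, ENNReal.ofReal_pow (by positivity)]
      gcongr
      exact volume_ball_le 0 _
    calc (ENNReal.ofReal z * volume (Metric.ball (0 : EuclideanSpace ℝ ι) k)).toReal ≤ (ENNReal.ofReal (z * (2 * (k : ℝ)) ^ Fintype.card ι)).toReal :=
          ENNReal.toReal_mono ENNReal.ofReal_ne_top h1
      _ = z * (2 * (k : ℝ)) ^ Fintype.card ι := ENNReal.toReal_ofReal (by positivity)
      _ ≤ B := hz64
  have hνW0 : 0 ≤ ν.real (window (Metric.ball (0 : EuclideanSpace ℝ ι) k)) := measureReal_nonneg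
  have hB0 : 0 ≤ B := by positivity
  have hexp : Real.exp (ν.real (window (Metric.ball (0 : EuclideanSpace ℝ ι) k))) ≤ Real.exp B := Real.exp_le_exp.2 hνW
  have hκ8 : 2 * (z * (2 * σ) ^ Fintype.card ι) ≤ 1 / 4 := by
    have h2σ : 0 < (2 * σ) ^ Fintype.card ι := by positivity
    calc 2 * (z * (2 * σ) ^ Fintype.card ι) ≤ 2 * (1 / (8 * (2 * σ) ^ Fintype.card ι) * (2 * σ) ^ Fintype.card ι) := by gcongr
      _ = 1 / 4 := by field_simp; norm_num
  have hpow : (2 * (z * (2 * σ) ^ Fintype.card ι)) ^ d ≤ (1 / 4 : ℝ) ^ d := pow_le_pow_left₀ (by positivity) hκ8 d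
  calc 2 * ν.real (window (Metric.ball (0 : EuclideanSpace ℝ ι) k)) * Real.exp (ν.real (window (Metric.ball (0 : EuclideanSpace ℝ ι) k))) *
        (2 * (z * (2 * σ) ^ Fintype.card ι)) ^ d
      ≤ 2 * B * Real.exp B * (1 / 4 : ℝ) ^ d := by gcongr
    _ = 2 * ((2 * (k : ℝ)) ^ Fintype.card ι / (8 * (2 * σ) ^ Fintype.card ι)) * Real.exp ((2 * (k : ℝ)) ^ Fintype.card ι / (8 * (2 * σ) ^ Fintype.card ι)) * (1 / 4 : ℝ) ^ d := by
        rw [hB]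


/-- **The vacancy probability of the low-activity DLR states is Lipschitz in the activity**
(Poisson vocabulary): for `ν_z = z · Leb ⊗ M`, `0 ≤ z, z' ≤ 1/(64σ³)`, and ANY DLR states `μ` of
`(σ, ν_z)` and `μ'` of `(σ, ν_{z'})`,
`|μ{B°_σ(0) × ℝ³ empty} - μ'{B°_σ(0) × ℝ³ empty}| ≤ L_σ |z - z'|` with `L_σ = ∫_{ℝ³} G_σ`: both are
pinned by the free finite-volume distributions, uniformly in the activity, and those are
`L_σ`-Lipschitz in `z` uniformly in the volume. [cite: Ruelle1969, §4.2, Thm 4.2.3] -/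
theorem abs_measureReal_vacant_sub_le_of_isHsLocalGibbs [Nonempty ι] (hσ : 0 < σ) {z z' : ℝ} (hz : 0 ≤ z)
    (hz1 : z ≤ 1 / (8 * (2 * σ) ^ Fintype.card ι)) (hz' : 0 ≤ z') (hz'1 : z' ≤ 1 / (8 * (2 * σ) ^ Fintype.card ι))
    {μ μ' : Measure (PointConfig (EuclideanSpace ℝ ι × EuclideanSpace ℝ ι))}
    (hμ : IsHsLocalGibbs σ ((Real.toNNReal z) • ((volume : Measure (EuclideanSpace ℝ ι)).prod M)) μ)
    (hμ' : IsHsLocalGibbs σ ((Real.toNNReal z') • ((volume : Measure (EuclideanSpace ℝ ι)).prod M)) μ') :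
    |μ.real {c : PointConfig (EuclideanSpace ℝ ι × EuclideanSpace ℝ ι) | c.count (window (Metric.ball (0 : EuclideanSpace ℝ ι) σ)) = 0} -
      μ'.real {c : PointConfig (EuclideanSpace ℝ ι × EuclideanSpace ℝ ι) | c.count (window (Metric.ball (0 : EuclideanSpace ℝ ι) σ)) = 0}| ≤
      (∫⁻ x : EuclideanSpace ℝ ι, ∑' n : ℕ, (Metric.ball (0 : EuclideanSpace ℝ ι) ((n + 1) * σ)).indicator
        (fun _ => ENNReal.ofReal (32 * (1 / 2) ^ n)) x).toReal * |z - z'| := by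
  set V : Set (PointConfig (EuclideanSpace ℝ ι × EuclideanSpace ℝ ι)) := {c | c.count (window (Metric.ball (0 : EuclideanSpace ℝ ι) σ)) = 0} with hV
  set L : ℝ := (∫⁻ x : EuclideanSpace ℝ ι, ∑' n : ℕ, (Metric.ball (0 : EuclideanSpace ℝ ι) ((n + 1) * σ)).indicator
    (fun _ => ENNReal.ofReal (32 * (1 / 2) ^ n)) x).toReal with hL
  set C : ℝ := 2 * ((2 * (⌈σ⌉₊ : ℕ)) ^ Fintype.card ι / (8 * (2 * σ) ^ Fintype.card ι)) * Real.exp ((2 * (⌈σ⌉₊ : ℕ)) ^ Fintype.card ι / (8 * (2 * σ) ^ Fintype.card ι)) with hC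
  have hC0 : 0 ≤ C := by positivity
  have habcd : ∀ a b c e : ℝ, |a - e| ≤ |a - b| + |b - c| + |c - e| := fun a b c e =>
    (abs_sub_le a c e).trans (by linarith [abs_sub_le a b c])
  -- for every `d`, compare through the free distribution in `B(0, ⌈σ⌉ + (d+2)σ)`
  have hd : ∀ d : ℕ, |μ.real V - μ'.real V| ≤ L * |z - z'| + 2 * C * (1 / 4 : ℝ) ^ d := by
    intro d
    set R : ℝ := (⌈σ⌉₊ : ℕ) + ((d : ℝ) + 2) * σ with hR
    have h1 := abs_measureReal_vacant_sub_hsLocalSpec_empty_le M hσ hz hz1 hμ d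
    have h2 := abs_measureReal_vacant_sub_hsLocalSpec_empty_le M hσ hz' hz'1 hμ' d
    have h3 := abs_hsLocalSpec_empty_vacant_sub_le (M := M) hσ hz hz1 hz' hz'1 R
    rw [← hV, ← hR, ← hC] at h1 h2
    rw [← hV, ← hL] at h3
    calc |μ.real V - μ'.real V| ≤ |μ.real V - (hsLocalSpec σ ((Real.toNNReal z) • ((volume : Measure (EuclideanSpace ℝ ι)).prod M))
            (Metric.ball 0 R) ∅ V).toReal| +
          |(hsLocalSpec σ ((Real.toNNReal z) • ((volume : Measure (EuclideanSpace ℝ ι)).prod M)) (Metric.ball 0 R) ∅ V).toReal -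
            (hsLocalSpec σ ((Real.toNNReal z') • ((volume : Measure (EuclideanSpace ℝ ι)).prod M)) (Metric.ball 0 R) ∅ V).toReal| +
          |(hsLocalSpec σ ((Real.toNNReal z') • ((volume : Measure (EuclideanSpace ℝ ι)).prod M)) (Metric.ball 0 R) ∅ V).toReal -
            μ'.real V| := habcd _ _ _ _
      _ ≤ C * (1 / 4 : ℝ) ^ d + L * |z - z'| + C * (1 / 4 : ℝ) ^ d := by
          gcongr
          rwa [abs_sub_comm] at h2
      _ = L * |z - z'| + 2 * C * (1 / 4 : ℝ) ^ d := by ring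
  refine le_of_forall_pos_le_add fun e he => ?_
  obtain ⟨d, hdlt⟩ := exists_pow_lt_of_lt_one (show 0 < e / (2 * C + 1) by positivity)
    (show (1 / 4 : ℝ) < 1 by norm_num)
  refine (hd d).trans ?_
  gcongr
  calc 2 * C * (1 / 4 : ℝ) ^ d ≤ 2 * C * (e / (2 * C + 1)) := by gcongr
    _ ≤ (2 * C + 1) * (e / (2 * C + 1)) := by gcongr; linarith
    _ = e := by field_simp

end Pinning

/-! ### The low-density uniqueness theorem in `ℝ^ι` -/

section LowDensity

variable {ε z z' β : ℝ} {u : EuclideanSpace ℝ ι}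

/-- **Lipschitz dependence of the vacancy probability on the activity** (`ℝ³`, DLR class
`IsHardSphereGibbs`): for `0 < ε`, `0 < β`, `0 ≤ z, z' ≤ 1/(64ε³)` and any solutions `G, G'` of the hard-sphere
DLR equations with activities `z, z'` (same `β, u`),
`|G{B°_ε(0) × ℝ³ empty} - G'{B°_ε(0) × ℝ³ empty}| ≤ L_ε |z - z'|`. [cite: Ruelle1969, §4.2, Thm 4.2.3] -/
theorem abs_measureReal_vacant_sub_le_of_isHardSphereGibbs [Nonempty ι] (hε : 0 < ε) (hβ : 0 < β) (hz : 0 ≤ z)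
    (hz1 : z ≤ 1 / (8 * (2 * ε) ^ Fintype.card ι)) (hz' : 0 ≤ z') (hz'1 : z' ≤ 1 / (8 * (2 * ε) ^ Fintype.card ι))
    {G G' : Measure (PointConfig (EuclideanSpace ℝ ι × EuclideanSpace ℝ ι))} (hG : IsHardSphereGibbs ε z β u G) (hG' : IsHardSphereGibbs ε z' β u G') :
    |G.real {c : PointConfig (EuclideanSpace ℝ ι × EuclideanSpace ℝ ι) | c.count (window (Metric.ball (0 : EuclideanSpace ℝ ι) ε)) = 0} -
      G'.real {c : PointConfig (EuclideanSpace ℝ ι × EuclideanSpace ℝ ι) | c.count (window (Metric.ball (0 : EuclideanSpace ℝ ι) ε)) = 0}| ≤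
      (∫⁻ x : EuclideanSpace ℝ ι, ∑' n : ℕ, (Metric.ball (0 : EuclideanSpace ℝ ι) ((n + 1) * ε)).indicator
        (fun _ => ENNReal.ofReal (32 * (1 / 2) ^ n)) x).toReal * |z - z'| := by
  haveI := isProbabilityMeasure_withDensity_maxwellianBeta (d := ι) hβ u
  exact abs_measureReal_vacant_sub_le_of_isHsLocalGibbs _ hε hz hz1 hz' hz'1
    (isHsLocalGibbs_of_isHardSphereGibbs hz hβ hG) (isHsLocalGibbs_of_isHardSphereGibbs hz' hβ hG')

/-- **Uniqueness of the translation-invariant hard-sphere Gibbs state at low density, `d = 3`**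
(the statement of `Literature.MathematicalPhysics.KineticTheory.HardSphereGibbsLowDensityUniqueness` in dimension three):
for every diameter `ε > 0` there is `ρ₀ > 0` such that two translation-invariant hard-sphere Gibbs
states (`IsHardSphereGibbs ε z β u`, `IsHardSphereGibbs ε z' β u`, activities `z, z' > 0`, `β > 0`) with the same
density `ρ < ρ₀` coincide: the GNZ sandwich gives `z, z' ≤ 2ρ`, the GNZ identity `ρ = z q(G) = z' q(G')`
with the Lipschitz bound `|q(G) - q(G')| ≤ L|z - z'|` and `q(G') ≥ 1/2` forces `z = z'`, and the DLR
state at small activity is unique. [cite: Ruelle1969, §4.2, Thm 4.2.3] -/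
theorem hardSphereGibbsLowDensityUniqueness_of_nonempty [Nonempty ι] (ε : ℝ) (hε : 0 < ε) : ∃ ρ₀ : ℝ, 0 < ρ₀ ∧
    ∀ (β : ℝ) (u : EuclideanSpace ℝ ι) (z z' : ℝ)
      (G G' : Measure (PointConfig (EuclideanSpace ℝ ι × EuclideanSpace ℝ ι))),
      0 < β → 0 < z → 0 < z' →
      IsHardSphereGibbs ε z β u G → IsHardSphereGibbs ε z' β u G' →
      IsTranslationInvariant G → IsTranslationInvariant G' →
      PointProcess.density G = PointProcess.density G' →
      PointProcess.density G < ENNReal.ofReal ρ₀ → G = G' := by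
  -- the constants
  set n₀ : ℕ := ⌈2 * ε⌉₊ with hn₀
  set L : ℝ := (∫⁻ x : EuclideanSpace ℝ ι, ∑' n : ℕ, (Metric.ball (0 : EuclideanSpace ℝ ι) ((n + 1) * ε)).indicator
    (fun _ => ENNReal.ofReal (32 * (1 / 2) ^ n)) x).toReal with hL
  have hL0 : 0 ≤ L := ENNReal.toReal_nonneg
  set ρ₀ : ℝ := min (1 / (2 * ((n₀ ^ Fintype.card ι : ℕ) : ℝ) + 2)) (min (1 / (16 * (2 * ε) ^ Fintype.card ι)) (1 / (8 * (L + 1)))) with hρ₀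
  have hρ₀pos : 0 < ρ₀ := by positivity
  have hρ₀1 : ρ₀ ≤ 1 / (2 * ((n₀ ^ Fintype.card ι : ℕ) : ℝ) + 2) := min_le_left _ _
  have hρ₀2 : ρ₀ ≤ 1 / (16 * (2 * ε) ^ Fintype.card ι) := (min_le_right _ _).trans (min_le_left _ _)
  have hρ₀3 : ρ₀ ≤ 1 / (8 * (L + 1)) := (min_le_right _ _).trans (min_le_right _ _)
  refine ⟨ρ₀, hρ₀pos, ?_⟩
  intro β u z z' G G' hβ hz hz' hG hG' hTI hTI' hdens hsmall
  -- the density as a real number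
  set r : ℝ := (PointProcess.density G).toReal with hr
  have hρtop : PointProcess.density G ≠ ∞ := (hsmall.trans ENNReal.ofReal_lt_top).ne
  have hρ : PointProcess.density G = ENNReal.ofReal r := (ENNReal.ofReal_toReal hρtop).symm
  have hρ' : PointProcess.density G' = ENNReal.ofReal r := hdens ▸ hρ
  have hr0 : 0 ≤ r := ENNReal.toReal_nonneg
  have hrρ₀ : r < ρ₀ := by
    have := ENNReal.toReal_strict_mono ENNReal.ofReal_ne_top hsmall
    rwa [ENNReal.toReal_ofReal hρ₀pos.le] at this
  -- (B): small density forces small activity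
  have hn : 2 * ε ≤ n₀ := Nat.le_ceil _
  have hρ1 : ((n₀ ^ Fintype.card ι : ℕ) : ℝ) * r ≤ 1 / 2 := by
    have hN : (0 : ℝ) ≤ ((n₀ ^ Fintype.card ι : ℕ) : ℝ) := Nat.cast_nonneg _
    have h1 : ((n₀ ^ Fintype.card ι : ℕ) : ℝ) * r ≤ ((n₀ ^ Fintype.card ι : ℕ) : ℝ) * (1 / (2 * ((n₀ ^ Fintype.card ι : ℕ) : ℝ) + 2)) :=
      mul_le_mul_of_nonneg_left (hrρ₀.le.trans hρ₀1) hN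
    refine h1.trans ?_
    rw [mul_one_div, div_le_iff₀ (by positivity)]
    linarith
  have hz2 : z ≤ 2 * r := activity_le_two_mul_density hG hTI hz.le hβ hn hρ hr0 hρ1
  have hz'2 : z' ≤ 2 * r := activity_le_two_mul_density hG' hTI' hz'.le hβ hn hρ' hr0 hρ1
  have hε3 : 0 < (2 * ε) ^ Fintype.card ι := by positivity
  have h16 : 2 * (1 / (16 * (2 * ε) ^ Fintype.card ι)) = 1 / (8 * (2 * ε) ^ Fintype.card ι) := by
    field_simp; norm_num
  have hz64 : z ≤ 1 / (8 * (2 * ε) ^ Fintype.card ι) := by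
    calc z ≤ 2 * r := hz2
      _ ≤ 2 * (1 / (16 * (2 * ε) ^ Fintype.card ι)) := by linarith [hrρ₀.le.trans hρ₀2]
      _ = 1 / (8 * (2 * ε) ^ Fintype.card ι) := h16
  have hz'64 : z' ≤ 1 / (8 * (2 * ε) ^ Fintype.card ι) := by
    calc z' ≤ 2 * r := hz'2
      _ ≤ 2 * (1 / (16 * (2 * ε) ^ Fintype.card ι)) := by linarith [hrρ₀.le.trans hρ₀2]
      _ = 1 / (8 * (2 * ε) ^ Fintype.card ι) := h16
  -- (C₀): `ρ = z q = z' q'`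
  set V : Set (PointConfig (EuclideanSpace ℝ ι × EuclideanSpace ℝ ι)) := {c | c.count (window (Metric.ball (0 : EuclideanSpace ℝ ι) ε)) = 0} with hV
  have hVeq : {X : PointConfig ((EuclideanSpace ℝ ι) × (EuclideanSpace ℝ ι)) | X.count (Metric.ball 0 ε ×ˢ (univ : Set (EuclideanSpace ℝ ι))) = 0} = V := rfl
  haveI : IsProbabilityMeasure G := hG.1
  haveI : IsProbabilityMeasure G' := hG'.1
  have hq : r = z * G.real V := by
    have h := density_eq_activity_mul_measure_ball_empty hG hTI hz.le hβ
    rw [hρ, hVeq] at h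
    have := congrArg ENNReal.toReal h
    rwa [ENNReal.toReal_ofReal hr0, ENNReal.toReal_mul, ENNReal.toReal_ofReal hz.le, ← measureReal_def] at this
  have hq' : r = z' * G'.real V := by
    have h := density_eq_activity_mul_measure_ball_empty hG' hTI' hz'.le hβ
    rw [hρ', hVeq] at h
    have := congrArg ENNReal.toReal h
    rwa [ENNReal.toReal_ofReal hr0, ENNReal.toReal_mul, ENNReal.toReal_ofReal hz'.le, ← measureReal_def] at this
  -- (C): the vacancy probabilities are `L`-Lipschitz in the activity
  have hLip := abs_measureReal_vacant_sub_le_of_isHardSphereGibbs hε hβ hz.le hz64 hz'.le hz'64 hG hG'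
  rw [← hV, ← hL] at hLip
  -- hence `z = z'`
  have hq'low : 1 ≤ 2 * G'.real V := by
    -- `r = z' q'`, `z' ≤ 2 r`, `z' > 0`
    have hrpos : 0 < r := by nlinarith
    nlinarith [hq', hz'2, measureReal_nonneg (μ := G') (s := V)]
  have hzz : z = z' := by
    by_contra hne
    have hne' : 0 < |z - z'| := abs_pos.2 (sub_ne_zero.2 hne)
    -- `|z - z'| q' = z |q - q'| ≤ z L |z - z'|`, so `q' ≤ z L ≤ 2 ρ₀ L < 1/4`
    have h1 : |z - z'| * G'.real V ≤ z * (L * |z - z'|) := by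
      have heq : (z' - z) * G'.real V = z * (G.real V - G'.real V) := by nlinarith [hq, hq']
      calc |z - z'| * G'.real V = |(z' - z) * G'.real V| := by
            rw [abs_mul, abs_sub_comm, abs_of_nonneg (measureReal_nonneg (μ := G') (s := V))]
        _ = z * |G.real V - G'.real V| := by rw [heq, abs_mul, abs_of_nonneg hz.le]
        _ ≤ z * (L * |z - z'|) := mul_le_mul_of_nonneg_left hLip hz.le
    have h2 : G'.real V ≤ z * L := by
      have := div_le_div_of_nonneg_right h1 hne'.le
      rw [mul_comm, mul_div_assoc, div_self hne'.ne', mul_one] at this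
      calc G'.real V ≤ z * (L * |z - z'|) / |z - z'| := this
        _ = z * L := by field_simp
    have h3 : z * L ≤ 2 * ρ₀ * L := by
      have : z ≤ 2 * ρ₀ := by linarith
      exact mul_le_mul_of_nonneg_right this hL0
    have h4 : 2 * ρ₀ * L < 1 / 2 := by
      have : ρ₀ * (L + 1) ≤ 1 / 8 := by
        calc ρ₀ * (L + 1) ≤ 1 / (8 * (L + 1)) * (L + 1) := by gcongr
          _ = 1 / 8 := by field_simp
      nlinarith
    linarith
  subst hzz
  -- (A): uniqueness at small activity
  have hzε : 2 * (z * (2 * ε) ^ Fintype.card ι) < 1 := by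
    have h2ε : 0 < (2 * ε) ^ Fintype.card ι := by positivity
    calc 2 * (z * (2 * ε) ^ Fintype.card ι) ≤ 2 * (1 / (8 * (2 * ε) ^ Fintype.card ι) * (2 * ε) ^ Fintype.card ι) := by gcongr
      _ = 1 / 4 := by field_simp; norm_num
      _ < 1 := by norm_num
  exact unique_of_isHardSphereGibbs_of_small_activity hε hz.le hzε hβ hG hG'

end LowDensity

end HardSphereDLR

end Literature.MathematicalPhysics.KineticTheory
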